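import Mathlib.Data.Nat.Size
import Mathlib.NumberTheory.ArithmeticFunction.Misc
import Mathlib.Data.List.Sort
import Mathlib.Logic.Equiv.Fin.Basic
import Literature.Computability.Cryptography.ShorProofs
import Literature.Computability.QuantumComplexity.BQPProofs
import Literature.Computability.Complexity.Randomized
import Literature.Computability.Complexity.Oracle
import HarnessLib

/-!
# Shor's factoring theorem, FBQP form: the randomised classical reduction (family PQC)

Second companion file of `Literature/Computability/Cryptography/Shor.lean` (after
`ShorProofs.lean`), towards the named facts `Literature.Computability.Cryptography.isQSolvable_factoring` /
`Literature.Computability.Cryptography.factoring_mem_FBQP` (Shor 1997, §5: the prime factorisation `Nat.primeFactorsList`,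
transported to Boolean strings, is computable in bounded-error quantum polynomial time). The
header of `ShorProofs.lean` names the layer still missing between the tree's named facts and
`isQSolvable_factoring`: the *randomised* classical wrap around Shor's order-finding theorem —
the random choice of `x`, the repetitions, the pre-tests for even numbers and prime powers, and
the recursion on the factors found until the factorisation is complete. This file **defines that
classical algorithm and proves its analysis**; the sibling `ShorAssembly.lean` states the two
closure principles of the circuit model it is fed to (as named facts) and assembles
`isQSolvable_factoring`.

## Content (everything in this file is proved)

* `Shor1997.splitStep m X` — one attempt of the printed reduction on `m` driven by a random
  block value `X`: `2` for even `m ≠ 2`; the least root `ppBase m` for a nontrivial perfect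
  power; otherwise `x = X mod 2^{size m}` is drawn, a draw `x = 0` or `x ≥ m` fails, a non-unit
  gives `gcd(x, m)`, and a unit of order `r` gives Shor's `gcd(x^{r/2} - 1, m)` if `r` is even
  and `x^{r/2} ≢ -1`. `splitStep_sound`: any answer is a nontrivial divisor (Shor's gcd
  criterion, `Shor1997.one_lt_gcd_pow_half_sub_one` of `ShorProofs`). `splitStep_fail_card`:
  for composite `m > 1` and `B ≥ size m`, at most `5/6` of the values `X < 2^B` fail (Shor's
  reduction bound `Shor1997_reduction_bound_holds` of `ShorProofs` with `k ≥ 2` distinct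
  primes — `two_le_card_primeFactors` — bounds the bad units by `φ(m)/2`, and the draw lands in
  `[1, m)` with probability `> 1/3`).
* The **work-list machine** `wstep`/`wrun` (state `WState`: finished numbers, and a stack of
  numbers to split with attempt budgets `≤ T`): split the top with the current block; on success
  push the two factors with budget `T`, on failure decrement, after `T` failures declare the top
  prime. Invariants `Inv1` (entries `> 1`, product `n`), `Inv2` (budgets), termination by the
  potential `pot` (`todo_wrun_eq_nil`: `T(2Ω(n) - 1)` rounds suffice, `Ω = ArithmeticFunction.cardFactors`), and the
  history invariant `Inv3` giving **the dichotomy** `wrun_dichotomy`: after enough rounds, either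
  the sorted output *is* `Nat.primeFactorsList n` (uniqueness of prime factorisation,
  `Nat.primeFactorsList_unique`), or some composite divisor `m` of `n` sat on top of the stack
  through an *episode* of `T` consecutive failed attempts.
* **Probability**: blocks are independent and an episode pins `T` of them into sets of density
  `≤ 5/6` determined by the past (`card_mul_card_filter_coord`, `card_filter_coord_le`,
  `card_cylinder_le` — a counting form of "independent trials", by an involution on
  `(sample, spare block)`); union over the `≤ R` starting rounds: `card_fail_le`,
  `uniformProb_fail_le` (`P[fail] ≤ R (5/6)^T` over `R·B` uniform coins, via the tree's
  `uniformProb` and `uniformProb_eq_card_ofFn`).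
* **Parameters and the string function**: for inputs `x` of length `L` (so
  `n = decodeNat x < 2^{L+1}`, `decodeNat_lt`): blocks of `B = L + 1` bits, budget
  `T = 32(L+1)`, `R = 64(L+1)²` rounds, `64(L+1)³` coins (`coinLen`, a polynomial);
  `shorClassical ⟨x, c⟩` runs the driver and outputs the encoded sorted list.
  `shorClassical_success`: for every `x`, `P_c[shorClassical ⟨x, c⟩ = encode (primeFactorsList
  (decodeNat x))] ≥ 3/4` (`rounds_mul_pow_le`: `R (5/6)^T ≤ 1/4`).

In `shorClassical` each order `ord_m(x)` is Mathlib's `orderOf (x : ZMod m)`, consulted only for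
`1 < m`, `0 < x < m`, `gcd(x, m) = 1` — exactly the promise of the tree's order-finding fact
`Shor1997_orderFinding_isQSolvable`; in the algorithm this value is supplied by the quantum
subroutine (see `ShorAssembly.lean`, where `shorClassical ∈ FP^{order oracle}` is the
programming fact and the subroutine is discharged by Shor's theorem).

## Sources

* P. W. Shor, *Polynomial-time algorithms for prime factorization and discrete logarithms on a
  quantum computer*, SIAM J. Comput. 26 (1997) 1484–1509, §5; page locators refer to
  arXiv:quant-ph/9508027v2 (§5 = pp. 15–19): the reduction and its success probability
  `1 - 1/2^{k-1}` (p. 16), "this scheme will thus work as long as `n` is odd and not a prime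
  power; finding factors of prime powers can be done efficiently with classical methods" (p. 16),
  order finding (pp. 15–19). The complete factorisation by recursion on the factors found, with
  repetition to amplify, is the standard reading of "factoring in BQP" (Nielsen–Chuang 2010,
  §5.3.2, book p. 233: "By repeating the procedure we may find a complete prime factorization
  of N"); the concrete schedule (`T` consecutive attempts per number, fixed coin blocks) and
  constants are ours and carry no citation (`[folklore]`).
* M. A. Nielsen, I. L. Chuang, *Quantum Computation and Quantum Information* (CUP 2010), §5.3.2,
  "Algorithm: Reduction of factoring to order-finding" (book p. 233; steps 1–3 are the even /
  perfect-power / gcd pre-tests, steps 4–5 order finding and Shor's gcd), App. A4.3.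

## Mathlib / tree

From Mathlib: `Nat.find`, `Nat.size` (`Nat.lt_size_self`, `Nat.size_le`, `Nat.lt_size`),
`Nat.primeFactors`, `Nat.eq_prime_pow_of_unique_prime_dvd`, `Nat.primeFactorsList`
(`Nat.primeFactorsList_unique`, `Nat.perm_primeFactorsList_mul`, `Nat.primeFactorsList_sorted`),
`List.insertionSort` (`List.perm_insertionSort`, `List.sortedLE_insertionSort`,
`List.Perm.eq_of_sortedLE`), `ZMod.unitOfCoprime`, `orderOf` (`orderOf_units`,
`pow_orderOf_eq_one`, `pow_ne_one_of_lt_orderOf`), `Nat.totient_lt`,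
`ZMod.card_units_eq_totient`, `Finset.card_equiv`, `Function.Involutive.toPerm`,
`Function.update`, `finFunctionFinEquiv`, `finProdFinEquiv`, `Equiv.curry`,
`Computability.decodeNat` (with `decodePosNum`). From the tree: `Shor1997.one_lt_gcd_pow_half_sub_one`,
`Shor1997_reduction_bound_holds` (`ShorProofs`), `uniformProb` (`Randomized`),
`uniformProb_eq_card_ofFn`, `uniformProb_compl` (`BQPProofs`), `boolPair`/`boolUnpair`,
`encodingListNatBool` (`BoolEncodings`), and Mathlib's `ArithmeticFunction.cardFactors` (`Ω`,
`cardFactors_mul`, `cardFactors_pos_iff_one_lt`). Mathlib has no perfect-power root (`ppBase`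
here, via `Nat.find`).

## Design choices

* The random candidate of an attempt on `m` is `X mod 2^{size m}` for a uniform block `X` of
  `B ≥ size m` bits (exactly uniform below `2^{size m}`; no rejection loop, a draw outside
  `[1, m)` simply counts as a failed attempt), so that all attempts consume blocks of the same
  length and block `t` is used in round `t` whatever happens — independence is then literal
  product structure (`card_cylinder_le`).
* Numbers are declared prime after `T` consecutive failures rather than by a primality test:
  no `PRIMES ∈ P` is needed, and the only error is declaring a composite prime, of probability
  `≤ (5/6)^T` per episode.
* Probabilities are counted (`Finset.card` over `Fin R → Fin B → Bool`) and converted to the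
  tree's real-valued `uniformProb` at the end; `Literature.Computability.Cryptography.uniformProb_mono` is a deliberate
  addition to the `uniformProb` API in its home namespace.
-/

noncomputable section

namespace Literature.Computability.Cryptography

open _root_.Computability Nat Complexity
open scoped ArithmeticFunction.Omega

namespace Shor1997

/-! ### One attempt at splitting a number -/

/-- The least `b` such that `m = b ^ k` for some `k ≥ 1` (so `ppBase m = m` unless `m` is a
nontrivial perfect power, in which case `ppBase m < m` is a nontrivial divisor). Shor: "finding
factors of prime powers can be done efficiently with classical methods" — integer roots.
[cite: Shor1997SICOMP, §5 p.16 (prime powers are handled classically)] -/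
def ppBase (m : ℕ) : ℕ :=
  Nat.find (⟨m, 1, by simp, Nat.one_pos, pow_one m⟩ :
    ∃ b, ∃ k ∈ Finset.range (m + 2), 0 < k ∧ b ^ k = m)

/-- `ppBase m` is a root of `m`: `m = (ppBase m) ^ k` for some `k ≥ 1`. [folklore] -/
theorem ppBase_spec (m : ℕ) : ∃ k : ℕ, 0 < k ∧ ppBase m ^ k = m := by
  obtain ⟨k, -, hk, h⟩ := Nat.find_spec (⟨m, 1, by simp, Nat.one_pos, pow_one m⟩ :
    ∃ b, ∃ k ∈ Finset.range (m + 2), 0 < k ∧ b ^ k = m)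
  exact ⟨k, hk, h⟩

/-- `ppBase m ≤ m` (`m = m ^ 1`). [folklore] -/
theorem ppBase_le (m : ℕ) : ppBase m ≤ m :=
  Nat.find_le ⟨1, by simp, Nat.one_pos, pow_one m⟩

/-- `ppBase m` is the least base: any `b > 1` with `b ^ k = m`, `k ≥ 1`, bounds it. [folklore] -/
theorem ppBase_le_of_pow_eq {m b k : ℕ} (hb : 1 < b) (hk : 0 < k) (h : b ^ k = m) :
    ppBase m ≤ b := by
  refine Nat.find_le ⟨k, ?_, hk, h⟩
  rw [Finset.mem_range]
  have : k < b ^ k := Nat.lt_pow_self hb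
  omega

/-- `ppBase m` divides `m`. [folklore] -/
theorem ppBase_dvd (m : ℕ) : ppBase m ∣ m := by
  obtain ⟨k, hk, h⟩ := ppBase_spec m
  conv_rhs => rw [← h]
  exact dvd_pow_self _ hk.ne'

/-- For `m > 1` the base is `> 1`. [folklore] -/
theorem one_lt_ppBase {m : ℕ} (hm : 1 < m) : 1 < ppBase m := by
  obtain ⟨k, hk, h⟩ := ppBase_spec m
  by_contra hle
  push Not at hle
  interval_cases hb : ppBase m
  · rw [zero_pow hk.ne'] at h; omega
  · rw [one_pow] at h; omega

/-- If `m > 1` is neither prime nor a nontrivial perfect power (`¬ ppBase m < m`), then `m` has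
at least two distinct prime factors (so Shor's bound `1 - 1/2^{k-1}` is `≥ 1/2`).
[cite: Shor1997SICOMP, §5 p.16 ("works as long as n is odd and not a prime power")] -/
theorem two_le_card_primeFactors {m : ℕ} (hm : 1 < m) (hp : ¬ m.Prime) (hpp : ¬ ppBase m < m) :
    2 ≤ m.primeFactors.card := by
  by_contra hlt
  push Not at hlt
  have hne : m.primeFactors.Nonempty := (Nat.nonempty_primeFactors).2 hm
  obtain ⟨p, hp1⟩ : ∃ p, m.primeFactors = {p} := Finset.card_eq_one.1 (by
    have := hne.card_pos; omega)
  have hpm : p ∈ m.primeFactors := by rw [hp1]; exact Finset.mem_singleton_self p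
  have hpp' : p.Prime := Nat.prime_of_mem_primeFactors hpm
  have huniq : ∀ {d : ℕ}, d.Prime → d ∣ m → d = p := by
    intro d hd hdm
    have : d ∈ m.primeFactors := (Nat.mem_primeFactors).2 ⟨hd, hdm, by omega⟩
    rw [hp1] at this; exact Finset.mem_singleton.1 this
  have hm_eq := Nat.eq_prime_pow_of_unique_prime_dvd (by omega) huniq
  set a := m.primeFactorsList.length with ha
  have ha0 : 0 < a := by
    rcases Nat.eq_zero_or_pos a with h0 | h0
    · rw [h0, pow_zero] at hm_eq; omega
    · exact h0
  have ha1 : a ≠ 1 := by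
    intro h1; rw [h1, pow_one] at hm_eq; exact hp (hm_eq ▸ hpp')
  have hple : ppBase m ≤ p := ppBase_le_of_pow_eq hpp'.one_lt ha0 hm_eq.symm
  have hplt : p < m := by
    calc p = p ^ 1 := (pow_one p).symm
      _ < p ^ a := Nat.pow_lt_pow_right hpp'.one_lt (by omega)
      _ = m := hm_eq.symm
  exact hpp (lt_of_le_of_lt hple hplt)

/-- One attempt of the randomised reduction on the number `m`, driven by the random block value
`X` (of which only the residue modulo `2 ^ size m`, a uniform number `x < 2 ^ size m`, is used):
even `m ≠ 2` yields the divisor `2`; a nontrivial perfect power yields its least root; otherwise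
`x = 0` or `x ≥ m` is a failed draw, a non-unit `0 < x < m` yields `gcd(x, m)`, and a unit `x`
of order `r` yields Shor's `gcd(x^{r/2} - 1, m)` when `r` is even and `x^{r/2} ≢ -1 (mod m)`,
and fails otherwise. This is steps 1–5 of Nielsen–Chuang's "Algorithm: Reduction of factoring to
order-finding" (§5.3.2, book p. 233) with Shor's criterion in step 5.
[cite: Shor1997SICOMP, §5 p.16 (reduction of factoring to order finding)]
[cite: NielsenChuang2010, §5.3.2 Algorithm "Reduction of factoring to order-finding" (book p. 233)] -/
def splitStep (m X : ℕ) : Option ℕ :=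
  if Even m then (if m = 2 then none else some 2)
  else if ppBase m < m then some (ppBase m)
  else
    let x := X % 2 ^ Nat.size m
    if x = 0 ∨ m ≤ x then none
    else if 1 < Nat.gcd x m then some (Nat.gcd x m)
    else
      let r := orderOf (x : ZMod m)
      if Even r ∧ ¬ m ∣ x ^ (r / 2) + 1 then some (Nat.gcd (x ^ (r / 2) - 1) m) else none

/-- **Soundness of one attempt**: a returned number is a nontrivial divisor of `m` (for the last
branch this is Shor's gcd criterion `Shor1997.one_lt_gcd_pow_half_sub_one`, `x ^ (r/2) ≢ 1`
being automatic for the order `r`). [cite: Shor1997SICOMP, §5 p.16 (reduction to order finding)] -/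
theorem splitStep_sound {m X d : ℕ} (hm : 1 < m) (h : splitStep m X = some d) :
    1 < d ∧ d < m ∧ d ∣ m := by
  unfold splitStep at h
  dsimp only at h
  split_ifs at h with h1 h2 h3 h4 h5 h6
  · cases Option.some.inj h
    obtain ⟨c, hc⟩ := h1
    refine ⟨by omega, by omega, ⟨c, by omega⟩⟩
  · cases Option.some.inj h
    exact ⟨one_lt_ppBase hm, h3, ppBase_dvd m⟩
  · cases Option.some.inj h
    push Not at h4
    refine ⟨h5, lt_of_le_of_lt (Nat.gcd_le_left _ (Nat.pos_of_ne_zero h4.1)) h4.2,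
      Nat.gcd_dvd_right _ _⟩
  · cases Option.some.inj h
    push Not at h4 h5
    set x := X % 2 ^ Nat.size m with hx
    set r := orderOf (x : ZMod m) with hr
    have hcop : x.Coprime m := by
      have hpos : 0 < Nat.gcd x m := Nat.gcd_pos_of_pos_right _ (by omega)
      exact le_antisymm h5 hpos
    haveI : NeZero m := ⟨by omega⟩
    have hfin : IsOfFinOrder (x : ZMod m) := by
      rw [← ZMod.coe_unitOfCoprime x hcop, ← orderOf_pos_iff, orderOf_units, orderOf_pos_iff]
      exact isOfFinOrder_of_finite _
    have hrpos : 0 < r := orderOf_pos_iff.2 hfin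
    have hxr : x ^ r ≡ 1 [MOD m] := by
      rw [← ZMod.natCast_eq_natCast_iff, Nat.cast_pow, Nat.cast_one]
      exact pow_orderOf_eq_one _
    have h1' : ¬ x ^ (r / 2) ≡ 1 [MOD m] := by
      intro hmod
      rw [← ZMod.natCast_eq_natCast_iff, Nat.cast_pow, Nat.cast_one] at hmod
      obtain ⟨c, hc⟩ := h6.1
      exact pow_ne_one_of_lt_orderOf (by omega) (by omega) hmod
    have key := Shor1997.one_lt_gcd_pow_half_sub_one hm h6.1 hxr h1' h6.2
    exact ⟨key.1, key.2, Nat.gcd_dvd_right _ _⟩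

end Shor1997

/-! ### The failure probability of one attempt -/

/-- Counting through a reduction modulo `c`: among `X < k * c`, the number with `P (X % c)` is
`k` times the number of `x < c` with `P x`. [folklore] -/
theorem card_filter_range_mul_mod (k c : ℕ) (P : ℕ → Prop) [DecidablePred P] :
    ((Finset.range (k * c)).filter fun X => P (X % c)).card =
      k * ((Finset.range c).filter P).card := by
  induction k with
  | zero => simp
  | succ k ih =>
    rw [Nat.succ_mul, Finset.range_add_eq_union, Finset.filter_union,
      Finset.card_union_of_disjoint, ih, Nat.succ_mul]
    · congr 1
      rw [Finset.filter_map, Finset.card_map]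
      congr 1
      refine Finset.filter_congr fun x hx => ?_
      rw [Finset.mem_range] at hx
      simp [Nat.mod_eq_of_lt hx]
    · refine Finset.disjoint_left.2 fun a ha hb => ?_
      simp only [Finset.mem_filter, Finset.mem_range, Finset.mem_map] at ha hb
      obtain ⟨⟨b, -, rfl⟩, -⟩ := hb
      have := ha.1
      simp only [addLeftEmbedding_apply] at this
      omega

namespace Shor1997

/-- The "bad" residues of the printed reduction, as natural numbers `0 < x < m` coprime to `m`:
the order `r` of `x` is odd, or `x ^ (r/2) ≡ -1 (mod m)`.
[cite: Shor1997SICOMP, §5 p.16 (r odd or x^(r/2) ≡ -1)] -/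
def badNat (m : ℕ) : Finset ℕ :=
  (Finset.range m).filter fun x => 0 < x ∧ x.Coprime m ∧
    (Odd (orderOf (x : ZMod m)) ∨ m ∣ x ^ (orderOf (x : ZMod m) / 2) + 1)

/-- The bad residues inject (`x ↦ unitOfCoprime x`) into the bad units counted by
`Shor1997_reduction_bound`. [folklore] -/
theorem card_badNat_le (m : ℕ) [NeZero m] :
    (badNat m).card ≤ (Finset.univ.filter fun u : (ZMod m)ˣ =>
      Odd (orderOf u) ∨ u ^ (orderOf u / 2) = -1).card := by
  classical
  let f : ℕ → (ZMod m)ˣ := fun x => if h : x.Coprime m then ZMod.unitOfCoprime x h else 1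
  refine Finset.card_le_card_of_injOn f (fun x hx => ?_) (fun x hx x' hx' hxx => ?_)
  · simp only [badNat, Finset.coe_filter, Finset.mem_range, Set.mem_setOf_eq] at hx
    obtain ⟨hxm, hx0, hcop, hbad⟩ := hx
    have hfx : (f x : ZMod m) = x := by
      show ((if h : x.Coprime m then ZMod.unitOfCoprime x h else 1 : (ZMod m)ˣ) : ZMod m) = x
      rw [dif_pos hcop, ZMod.coe_unitOfCoprime]
    have hord : orderOf (f x) = orderOf (x : ZMod m) := by rw [← orderOf_units, hfx]
    simp only [Finset.coe_filter, Finset.mem_univ, true_and, Set.mem_setOf_eq, hord]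
    rcases hbad with hodd | hdvd
    · exact Or.inl hodd
    · right
      rw [← ZMod.natCast_eq_zero_iff] at hdvd
      push_cast at hdvd
      ext
      rw [Units.val_pow_eq_pow_val, hfx, Units.val_neg, Units.val_one]
      exact eq_neg_of_add_eq_zero_left hdvd
  · simp only [badNat, Finset.coe_filter, Finset.mem_range, Set.mem_setOf_eq] at hx hx'
    have h1 : (f x : ZMod m) = x := by
      show ((if h : x.Coprime m then ZMod.unitOfCoprime x h else 1 : (ZMod m)ˣ) : ZMod m) = x
      rw [dif_pos hx.2.2.1, ZMod.coe_unitOfCoprime]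
    have h2 : (f x' : ZMod m) = x' := by
      show ((if h : x'.Coprime m then ZMod.unitOfCoprime x' h else 1 : (ZMod m)ˣ) : ZMod m) = x'
      rw [dif_pos hx'.2.2.1, ZMod.coe_unitOfCoprime]
    have : (x : ZMod m) = x' := by rw [← h1, ← h2, hxx]
    rw [ZMod.natCast_eq_natCast_iff', Nat.mod_eq_of_lt hx.1, Nat.mod_eq_of_lt hx'.1] at this
    exact this

/-- Twice the number of bad residues is at most `φ(m)` once the odd `m` has at least two distinct
prime factors: Shor's reduction bound `1 - 1/2^{k-1}` (`Shor1997_reduction_bound_holds`) with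
`k ≥ 2`. [cite: Shor1997SICOMP, §5 p.16 (probability at least 1 - 1/2^(k-1))] -/
theorem two_mul_card_badNat_le {m : ℕ} (hm : 1 < m) (hodd : Odd m)
    (hk : 2 ≤ m.primeFactors.card) : 2 * (badNat m).card ≤ Nat.totient m := by
  haveI : NeZero m := ⟨by omega⟩
  have h := Shor1997_reduction_bound_holds m hodd
  rw [ZMod.card_units_eq_totient] at h
  have h2 : 2 ≤ 2 ^ (m.primeFactors.card - 1) := by
    calc 2 = 2 ^ 1 := rfl
      _ ≤ 2 ^ (m.primeFactors.card - 1) := Nat.pow_le_pow_right (by norm_num) (by omega)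
  calc 2 * (badNat m).card ≤ 2 ^ (m.primeFactors.card - 1) * (Finset.univ.filter
        fun u : (ZMod m)ˣ => Odd (orderOf u) ∨ u ^ (orderOf u / 2) = -1).card :=
        Nat.mul_le_mul h2 (card_badNat_le m)
    _ ≤ Nat.totient m := by rw [mul_comm]; exact h

/-- A failed attempt on an odd non-perfect-power `m` comes from a draw `x = 0`, `x ≥ m`, or a
bad residue (non-units never fail). [folklore] -/
theorem splitStep_eq_none_imp {m X : ℕ} (hodd : ¬ Even m) (hpp : ¬ ppBase m < m)
    (h : splitStep m X = none) :
    X % 2 ^ m.size = 0 ∨ m ≤ X % 2 ^ m.size ∨ X % 2 ^ m.size ∈ badNat m := by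
  unfold splitStep at h
  dsimp only at h
  simp only [hodd, if_false, hpp] at h
  split_ifs at h with h4 h5 h6
  · rcases h4 with h4 | h4
    · exact Or.inl h4
    · exact Or.inr (Or.inl h4)
  · push Not at h4 h5
    right; right
    simp only [badNat, Finset.mem_filter, Finset.mem_range]
    have hpos : 0 < Nat.gcd (X % 2 ^ m.size) m := Nat.gcd_pos_of_pos_left _ (by omega)
    refine ⟨h4.2, by omega, le_antisymm h5 hpos, ?_⟩
    rw [← Nat.not_even_iff_odd]
    tauto

/-- **Failure probability of one attempt** (Shor 1997, §5, p. 16: a random `x` yields a factor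
with probability `≥ 1 - 1/2^{k-1} ≥ 1/2` when `n` is odd with `k ≥ 2` distinct prime factors;
here combined with the draw of `x < 2^{size m}`, which lands in `[1, m)` with probability
`> 1/3`): for composite `m > 1` and any block length `B ≥ size m`, at most `5/6` of the block
values `X < 2 ^ B` fail. (Even `m` and perfect powers never fail.)
[cite: Shor1997SICOMP, §5 p.16 (success probability of the reduction)] -/
theorem splitStep_fail_card {m B : ℕ} (hm : 1 < m) (hp : ¬ m.Prime) (hB : m.size ≤ B) :
    6 * ((Finset.range (2 ^ B)).filter fun X => splitStep m X = none).card ≤ 5 * 2 ^ B := by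
  by_cases heven : Even m
  · have : ((Finset.range (2 ^ B)).filter fun X => splitStep m X = none) = ∅ := by
      refine Finset.filter_false_of_mem fun X _ => ?_
      have hm2 : m ≠ 2 := fun h2 => hp (h2 ▸ Nat.prime_two)
      simp [splitStep, heven, hm2]
    rw [this]; simp
  by_cases hpp : ppBase m < m
  · have : ((Finset.range (2 ^ B)).filter fun X => splitStep m X = none) = ∅ := by
      refine Finset.filter_false_of_mem fun X _ => ?_
      simp [splitStep, heven, hpp]
    rw [this]; simp
  -- the main case: `m` odd, composite, not a perfect power
  have hodd : Odd m := Nat.not_even_iff_odd.1 heven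
  have hm3 : 3 ≤ m := by
    obtain ⟨c, hc⟩ := hodd; omega
  have hms : m < 2 ^ m.size := Nat.lt_size_self m
  have h2s : 2 ^ m.size ≤ 2 * m := by
    have hspos : 0 < m.size := Nat.size_pos.2 (by omega)
    have : 2 ^ (m.size - 1) ≤ m := Nat.lt_size.1 (by omega)
    calc 2 ^ m.size = 2 * 2 ^ (m.size - 1) := by rw [← pow_succ']; congr 1; omega
      _ ≤ 2 * m := by omega
  -- count modulo `2 ^ size m`
  have hsub : ((Finset.range (2 ^ m.size)).filter fun x => splitStep m x = none) ⊆
      {0} ∪ Finset.Ico m (2 ^ m.size) ∪ badNat m := by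
    intro x hx
    simp only [Finset.mem_filter, Finset.mem_range] at hx
    have hxs : x % 2 ^ m.size = x := Nat.mod_eq_of_lt hx.1
    have := splitStep_eq_none_imp heven hpp hx.2
    rw [hxs] at this
    simp only [Finset.mem_union, Finset.mem_singleton, Finset.mem_Ico]
    rcases this with h0 | hle | hbad
    · exact Or.inl (Or.inl h0)
    · exact Or.inl (Or.inr ⟨hle, hx.1⟩)
    · exact Or.inr hbad
  have hcard : 6 * ((Finset.range (2 ^ m.size)).filter fun x => splitStep m x = none).card ≤
      5 * 2 ^ m.size := by
    have hc := Finset.card_le_card hsub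
    have hu1 := Finset.card_union_le ({0} ∪ Finset.Ico m (2 ^ m.size)) (badNat m)
    have hu2 := Finset.card_union_le ({0} : Finset ℕ) (Finset.Ico m (2 ^ m.size))
    rw [Finset.card_singleton, Nat.card_Ico] at hu2
    have hbad := two_mul_card_badNat_le hm hodd (two_le_card_primeFactors hm hp hpp)
    have htot := Nat.totient_lt m hm
    omega
  -- lift to `B` bits through `X ↦ X % 2 ^ size m`
  have hsplit : ∀ X, splitStep m X = splitStep m (X % 2 ^ m.size) := by
    intro X
    simp only [splitStep, Nat.mod_mod]
  obtain ⟨e, rfl⟩ := Nat.exists_eq_add_of_le hB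
  rw [show 2 ^ (m.size + e) = 2 ^ e * 2 ^ m.size by rw [pow_add, mul_comm]]
  have hcongr : ((Finset.range (2 ^ e * 2 ^ m.size)).filter fun X => splitStep m X = none) =
      (Finset.range (2 ^ e * 2 ^ m.size)).filter fun X => splitStep m (X % 2 ^ m.size) = none :=
    Finset.filter_congr fun X _ => by rw [← hsplit]
  rw [hcongr, card_filter_range_mul_mod (2 ^ e) (2 ^ m.size) (fun x => splitStep m x = none)]
  calc 6 * (2 ^ e * ((Finset.range (2 ^ m.size)).filter fun x => splitStep m x = none).card)
      = 2 ^ e * (6 * ((Finset.range (2 ^ m.size)).filter fun x => splitStep m x = none).card) := by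
        ring
    _ ≤ 2 ^ e * (5 * 2 ^ m.size) := Nat.mul_le_mul_left _ hcard
    _ = 5 * (2 ^ e * 2 ^ m.size) := by ring

/-! ### The work-list machine of the recursive factorisation -/

/-- State of the classical driver: the finished factors `done` and a stack `todo` of pairs
`(m, k)` — a factor `m > 1` of `n` still to be split, with `k` attempts left. [folklore] -/
structure WState where
  /-- Numbers declared prime (no factor found in `T` consecutive attempts). -/
  done : List ℕ
  /-- Stack of numbers still to be split, with their remaining attempt budgets. -/
  todo : List (ℕ × ℕ)

/-- One round: attempt to split the top of the stack with the block value `X`; on success push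
the two factors with fresh budgets `T`, on failure decrement the budget, and after the last
allowed failure declare the number prime. An empty stack idles. ("By repeating the procedure
we may find a complete prime factorization of N", Nielsen–Chuang §5.3.2, book p. 233.)
[cite: NielsenChuang2010, §5.3.2 (book p. 233: repeating the reduction gives the complete factorization)] -/
def wstep (T : ℕ) (s : WState) (X : ℕ) : WState :=
  match s.todo with
  | [] => s
  | (m, k) :: rest =>
    match splitStep m X with
    | some d => ⟨s.done, (d, T) :: (m / d, T) :: rest⟩
    | none => if k ≤ 1 then ⟨m :: s.done, rest⟩ else ⟨s.done, (m, k - 1) :: rest⟩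

/-- `t` rounds of the driver, round `i` consuming the block value `X i`. [folklore] -/
def wrun (T : ℕ) (X : ℕ → ℕ) (s₀ : WState) : ℕ → WState
  | 0 => s₀
  | t + 1 => wstep T (wrun T X s₀ t) (X t)

/-- Initial state for factoring `n` with per-number budget `T`. [folklore] -/
def winit (n T : ℕ) : WState := ⟨[], [(n, T)]⟩

/-- All numbers held by a state. [folklore] -/
def WState.entries (s : WState) : List ℕ := s.done ++ s.todo.map Prod.fst

/-- Invariant 1: the numbers held are `> 1` and multiply to `n`. [folklore] -/
def Inv1 (n : ℕ) (s : WState) : Prop := s.entries.prod = n ∧ ∀ m ∈ s.entries, 1 < m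

/-- Invariant 2: budgets lie in `[1, T]`, and below the top of the stack they equal `T`.
[folklore] -/
def Inv2 (T : ℕ) (s : WState) : Prop :=
  (∀ e ∈ s.todo, 1 ≤ e.2 ∧ e.2 ≤ T) ∧ ∀ e ∈ s.todo.tail, e.2 = T

/-- Zero rounds. [folklore] -/
@[simp] theorem wrun_zero (T : ℕ) (X : ℕ → ℕ) (s₀ : WState) : wrun T X s₀ 0 = s₀ := rfl

/-- One more round. [folklore] -/
theorem wrun_succ (T : ℕ) (X : ℕ → ℕ) (s₀ : WState) (t : ℕ) :
    wrun T X s₀ (t + 1) = wstep T (wrun T X s₀ t) (X t) := rfl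

/-- An empty stack idles. [folklore] -/
theorem wstep_nil {T X : ℕ} {s : WState} (h : s.todo = []) : wstep T s X = s := by
  unfold wstep; split <;> simp_all

/-- The run up to round `t` only depends on the block values before `t`. [folklore] -/
theorem wrun_congr {T : ℕ} {X X' : ℕ → ℕ} {s₀ : WState} {t : ℕ} (h : ∀ i < t, X i = X' i) :
    wrun T X s₀ t = wrun T X' s₀ t := by
  induction t with
  | zero => rfl
  | succ t ih =>
    rw [wrun_succ, wrun_succ, ih fun i hi => h i (by omega), h t (by omega)]

/-- Invariant 1 holds initially. [folklore] -/
theorem inv1_winit {n : ℕ} (hn : 1 < n) (T : ℕ) : Inv1 n (winit n T) := by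
  simp [Inv1, winit, WState.entries, hn]

/-- Invariant 2 holds initially (`T ≥ 1`). [folklore] -/
theorem inv2_winit (n : ℕ) {T : ℕ} (hT : 1 ≤ T) : Inv2 T (winit n T) := by
  simp [Inv2, winit, hT]

/-- Invariant 1 is preserved by a round: a split replaces `m` by `d, m/d` with `d · (m/d) = m`,
both `> 1` (`splitStep_sound`); the other transitions only move numbers. [folklore] -/
theorem inv1_wstep {n T X : ℕ} {s : WState} (h : Inv1 n s) : Inv1 n (wstep T s X) := by
  obtain ⟨hprod, hgt⟩ := h
  unfold wstep
  split
  · exact ⟨hprod, hgt⟩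
  · rename_i m k rest htodo
    simp only [WState.entries, htodo, List.map_cons, List.prod_append, List.prod_cons,
      List.mem_append, List.mem_cons, List.mem_map] at hprod hgt
    have hm : 1 < m := hgt m (Or.inr (Or.inl rfl))
    split
    · rename_i d hd
      obtain ⟨hd1, hdm, hdvd⟩ := splitStep_sound hm hd
      have hmd : d * (m / d) = m := Nat.mul_div_cancel' hdvd
      have hmd1 : 1 < m / d := by
        by_contra hle; push Not at hle
        have : d * (m / d) ≤ d * 1 := Nat.mul_le_mul_left d hle
        omega
      refine ⟨?_, ?_⟩
      · simp only [WState.entries, List.map_cons, List.prod_append, List.prod_cons, ← hprod,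
          ← mul_assoc, hmd]
      · simp only [WState.entries, List.map_cons, List.mem_append, List.mem_cons, List.mem_map]
        rintro x (hx | rfl | rfl | hx)
        · exact hgt x (Or.inl hx)
        · exact hd1
        · exact hmd1
        · exact hgt x (Or.inr (Or.inr hx))
    · split
      · refine ⟨?_, ?_⟩
        · simp only [WState.entries, List.prod_append, List.prod_cons, ← hprod]; ring
        · simp only [WState.entries, List.mem_append, List.mem_cons, List.mem_map]
          rintro x ((rfl | hx) | hx)
          · exact hm
          · exact hgt x (Or.inl hx)
          · exact hgt x (Or.inr (Or.inr hx))
      · refine ⟨?_, ?_⟩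
        · simp only [WState.entries, List.map_cons, List.prod_append, List.prod_cons, ← hprod]
        · simp only [WState.entries, List.map_cons, List.mem_append, List.mem_cons, List.mem_map]
          rintro x (hx | rfl | hx)
          · exact hgt x (Or.inl hx)
          · exact hm
          · exact hgt x (Or.inr (Or.inr hx))

/-- Invariant 2 is preserved by a round (`T ≥ 1`): pushes carry budget `T`, only the top budget
is decremented, and never below `1`. [folklore] -/
theorem inv2_wstep {T X : ℕ} {s : WState} (hT : 1 ≤ T) (h : Inv2 T s) : Inv2 T (wstep T s X) := by
  obtain ⟨hb, htail⟩ := h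
  unfold wstep
  split
  · exact ⟨hb, htail⟩
  · rename_i m k rest htodo
    rw [htodo] at hb htail
    simp only [List.tail_cons, List.mem_cons] at hb htail
    split
    · refine ⟨?_, ?_⟩
      · simp only [List.mem_cons]
        rintro e (rfl | rfl | he)
        · exact ⟨hT, le_rfl⟩
        · exact ⟨hT, le_rfl⟩
        · exact hb e (Or.inr he)
      · simp only [List.tail_cons, List.mem_cons]
        rintro e (rfl | he)
        · rfl
        · exact htail e he
    · split
      · refine ⟨fun e he => hb e (Or.inr he), fun e he => htail e (List.mem_of_mem_tail he)⟩
      · rename_i hk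
        refine ⟨?_, ?_⟩
        · simp only [List.mem_cons]
          rintro e (rfl | he)
          · have := hb (m, k) (Or.inl rfl); simp only at this ⊢; omega
          · exact hb e (Or.inr he)
        · simpa using htail

/-- Invariant 1 along the run. [folklore] -/
theorem inv1_wrun {n T : ℕ} {X : ℕ → ℕ} {s₀ : WState} (h : Inv1 n s₀) (t : ℕ) :
    Inv1 n (wrun T X s₀ t) := by
  induction t with
  | zero => exact h
  | succ t ih => exact inv1_wstep ih

/-- Invariant 2 along the run. [folklore] -/
theorem inv2_wrun {T : ℕ} {X : ℕ → ℕ} {s₀ : WState} (hT : 1 ≤ T) (h : Inv2 T s₀) (t : ℕ) :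
    Inv2 T (wrun T X s₀ t) := by
  induction t with
  | zero => exact h
  | succ t ih => exact inv2_wstep hT ih

/-- Entries divide `n`. [folklore] -/
theorem Inv1.dvd_of_mem {n : ℕ} {s : WState} (h : Inv1 n s) {m : ℕ} (hm : m ∈ s.entries) :
    m ∣ n :=
  h.1 ▸ List.dvd_prod hm

/-! ### Termination: a potential -/

/-- `Ω(m) ≥ 1` for `m > 1` (`Ω = ArithmeticFunction.cardFactors`, prime factors counted with
multiplicity). [folklore] -/
theorem one_le_cardFactors {m : ℕ} (hm : 1 < m) : 1 ≤ Ω m :=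
  ArithmeticFunction.cardFactors_pos_iff_one_lt.2 hm

/-- `Ω` is additive: `Ω(d) + Ω(m/d) = Ω(m)` for `d ∣ m`, `m > 1`. [folklore] -/
theorem cardFactors_add_cardFactors_div {m d : ℕ} (hm : 1 < m) (hd : d ∣ m) :
    Ω d + Ω (m / d) = Ω m := by
  have hd0 : d ≠ 0 := by rintro rfl; rw [zero_dvd_iff] at hd; omega
  have hmd0 : m / d ≠ 0 := by
    intro h0; have := Nat.mul_div_cancel' hd; rw [h0, mul_zero] at this; omega
  rw [← ArithmeticFunction.cardFactors_mul hd0 hmd0, Nat.mul_div_cancel' hd]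

/-- `2 ^ Ω(m) ≤ m` for `m ≠ 0` (every prime factor is `≥ 2`). [folklore] -/
theorem two_pow_cardFactors_le {m : ℕ} (hm : m ≠ 0) : 2 ^ Ω m ≤ m := by
  rw [ArithmeticFunction.cardFactors_apply]
  calc 2 ^ m.primeFactorsList.length ≤ m.primeFactorsList.prod :=
        List.pow_card_le_prod _ _ fun p hp => (Nat.prime_of_mem_primeFactorsList hp).two_le
    _ = m := Nat.prod_primeFactorsList hm

/-- The potential: an entry `(m, k)` may still cost `k` rounds itself and `T` rounds for each of
the at most `2 Ω(m) - 2` entries below it in its splitting tree (`ℕ`-subtraction harmless: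
`Ω(m) ≥ 1` for the entries `m > 1` of Invariant 1). [folklore] -/
def pot (T : ℕ) (s : WState) : ℕ :=
  (s.todo.map fun e => e.2 + T * (2 * Ω e.1 - 2)).sum

/-- The initial potential: `T (2 Ω(n) - 1)`. [folklore] -/
theorem pot_winit (n T : ℕ) : pot T (winit n T) = T + T * (2 * Ω n - 2) := by
  simp [pot, winit]

/-- A nonempty stack has positive potential (its top budget is `≥ 1`). [folklore] -/
theorem one_le_pot {T : ℕ} {s : WState} (h2 : Inv2 T s) (hne : s.todo ≠ []) : 1 ≤ pot T s := by
  obtain ⟨e, rest, he⟩ := List.exists_cons_of_ne_nil hne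
  have := (h2.1 e (by rw [he]; exact List.mem_cons_self)).1
  simp only [pot, he, List.map_cons, List.sum_cons]
  omega

/-- **The potential drops every busy round**: a split trades `k + T(2Ω(m) - 2)` for
`2T + T(2Ω(d) - 2) + T(2Ω(m/d) - 2) = T(2Ω(m) - 2)` (additivity of `Ω`), a failure decrements
`k`, an abandonment removes a whole term. [folklore] -/
theorem pot_wstep {n T X : ℕ} {s : WState} (h1 : Inv1 n s) (h2 : Inv2 T s) (hne : s.todo ≠ []) :
    pot T (wstep T s X) + 1 ≤ pot T s := by
  unfold wstep
  split
  · rename_i h; exact absurd h hne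
  · rename_i m k rest htodo
    have hm : 1 < m := h1.2 m (by simp [WState.entries, htodo])
    have hk : 1 ≤ k := (h2.1 (m, k) (by rw [htodo]; exact List.mem_cons_self)).1
    have hpot : pot T s = k + T * (2 * Ω m - 2) +
        (rest.map fun e => e.2 + T * (2 * Ω e.1 - 2)).sum := by
      simp [pot, htodo]
    split
    · rename_i d hd
      obtain ⟨hd1, hdm, hdvd⟩ := splitStep_sound hm hd
      have hΩ := cardFactors_add_cardFactors_div hm hdvd
      have hΩd := one_le_cardFactors hd1
      have hΩmd : 1 ≤ Ω (m / d) := by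
        refine one_le_cardFactors ?_
        by_contra hle; push Not at hle
        have := Nat.mul_div_cancel' hdvd
        have : d * (m / d) ≤ d * 1 := Nat.mul_le_mul_left d hle
        omega
      rw [hpot]
      simp only [pot, List.map_cons, List.sum_cons]
      obtain ⟨a, ha⟩ : ∃ a, Ω d = a + 1 := ⟨_, (Nat.sub_add_cancel hΩd).symm⟩
      obtain ⟨b, hb⟩ : ∃ b, Ω (m / d) = b + 1 := ⟨_, (Nat.sub_add_cancel hΩmd).symm⟩
      rw [ha, hb, ← hΩ, ha, hb]
      have e1 : 2 * (a + 1) - 2 = 2 * a := by omega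
      have e2 : 2 * (b + 1) - 2 = 2 * b := by omega
      have e3 : 2 * (a + 1 + (b + 1)) - 2 = 2 * a + 2 * b + 2 := by omega
      rw [e1, e2, e3]
      nlinarith
    · split
      · rw [hpot]; simp only [pot]; omega
      · rw [hpot]; simp only [pot, List.map_cons, List.sum_cons]; omega

/-- After `t` rounds, either the stack is empty or the potential has dropped by `t`. [folklore] -/
theorem pot_wrun {n T : ℕ} {X : ℕ → ℕ} {s₀ : WState} (hT : 1 ≤ T) (h1 : Inv1 n s₀)
    (h2 : Inv2 T s₀) (t : ℕ) :
    (wrun T X s₀ t).todo = [] ∨ pot T (wrun T X s₀ t) + t ≤ pot T s₀ := by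
  induction t with
  | zero => exact Or.inr (by simp)
  | succ t ih =>
    by_cases hnil : (wrun T X s₀ t).todo = []
    · left; rw [wrun_succ, wstep_nil hnil]; exact hnil
    · right
      rcases ih with h | h
      · exact absurd h hnil
      · have := pot_wstep (X := X t) (inv1_wrun h1 t) (inv2_wrun hT h2 t) hnil
        rw [wrun_succ]; omega

/-- **Termination**: after `pot T s₀` rounds the stack is empty. [folklore] -/
theorem todo_wrun_eq_nil {n T : ℕ} {X : ℕ → ℕ} {s₀ : WState} (hT : 1 ≤ T) (h1 : Inv1 n s₀)
    (h2 : Inv2 T s₀) {t : ℕ} (ht : pot T s₀ ≤ t) : (wrun T X s₀ t).todo = [] := by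
  rcases pot_wrun (X := X) hT h1 h2 t with h | h
  · exact h
  · by_contra hne
    have := one_le_pot (inv2_wrun (X := X) hT h2 t) hne
    omega

/-! ### A wrong answer requires `T` consecutive failures on a composite number -/

section Episodes

variable (T : ℕ) (X : ℕ → ℕ) (s₀ : WState)

/-- An *episode* for `m` starting at round `j`: `m` sits on top of the stack with its full
budget `T` before round `j`, and the attempts of rounds `j, …, j + T - 1` on `m` all fail.
[folklore] -/
def Episode (m j : ℕ) : Prop :=
  (wrun T X s₀ j).todo.head? = some (m, T) ∧ ∀ i < T, splitStep m (X (j + i)) = none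

/-- Invariant 3 (history): the top entry `(m, k)` has been on top since round `t - (T - k)`,
failing ever since; every finished number went through a full episode. [folklore] -/
def Inv3 (t : ℕ) : Prop :=
  (∀ m k rest, (wrun T X s₀ t).todo = (m, k) :: rest →
      T - k ≤ t ∧ (wrun T X s₀ (t - (T - k))).todo.head? = some (m, T) ∧
        ∀ i < T - k, splitStep m (X (t - (T - k) + i)) = none) ∧
  ∀ m ∈ (wrun T X s₀ t).done, ∃ j, j + T ≤ t ∧ Episode T X s₀ m j

variable {T X s₀}

/-- Invariant 3 holds initially. [folklore] -/
theorem inv3_zero {n : ℕ} (h : s₀ = winit n T) : Inv3 T X s₀ 0 := by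
  subst h
  refine ⟨fun m k rest heq => ?_, fun m hm => ?_⟩
  · simp only [wrun_zero, winit, List.cons.injEq, Prod.mk.injEq] at heq
    obtain ⟨⟨rfl, rfl⟩, -⟩ := heq
    simp [winit]
  · simp [winit] at hm

/-- Invariant 3 is preserved by a round: a split puts a fresh entry on top (empty history); a
failure extends the history of the top entry by the current round; an abandonment closes the
history of the top entry into a full episode and exposes the next entry, whose budget is `T`
(Invariant 2). [folklore] -/
theorem inv3_succ (hT : 1 ≤ T) (h2 : Inv2 T s₀) {t : ℕ} (h : Inv3 T X s₀ t) :
    Inv3 T X s₀ (t + 1) := by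
  obtain ⟨htop, hdone⟩ := h
  have hI2 := inv2_wrun (X := X) hT h2 t
  rcases htodo : (wrun T X s₀ t).todo with _ | ⟨⟨m, k⟩, rest⟩
  · -- idle round
    have hs : wrun T X s₀ (t + 1) = wrun T X s₀ t := by rw [wrun_succ, wstep_nil htodo]
    rw [Inv3, hs, htodo]
    exact ⟨fun m k rest heq => by simp at heq, fun m hm => by
      obtain ⟨j, hj, he⟩ := hdone m hm; exact ⟨j, by omega, he⟩⟩
  · obtain ⟨hle, hhead, hfail⟩ := htop m k rest htodo
    have hk := hI2.1 (m, k) (by rw [htodo]; exact List.mem_cons_self)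
    simp only at hk
    rcases hsplit : splitStep m (X t) with _ | d
    · by_cases hk1 : k ≤ 1
      · -- abandon `m`
        have hk1' : k = 1 := by omega
        subst hk1'
        have hs : wrun T X s₀ (t + 1) = ⟨m :: (wrun T X s₀ t).done, rest⟩ := by
          rw [wrun_succ]; unfold wstep; simp only [htodo, hsplit]; simp
        rw [Inv3, hs]
        refine ⟨fun m' k' rest' heq => ?_, fun m' hm' => ?_⟩
        · simp only at heq
          subst heq
          have hk' : k' = T := hI2.2 (m', k') (by rw [htodo]; simp)
          subst hk'
          refine ⟨by omega, ?_, fun i hi => by omega⟩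
          simp only [Nat.sub_self, Nat.sub_zero, hs, List.head?_cons]
        · simp only [List.mem_cons] at hm'
          rcases hm' with rfl | hm'
          · refine ⟨t - (T - 1), by omega, hhead, fun i hi => ?_⟩
            rcases Nat.lt_or_ge i (T - 1) with hi' | hi'
            · exact hfail i hi'
            · have : t - (T - 1) + i = t := by omega
              rw [this]; exact hsplit
          · obtain ⟨j, hj, he⟩ := hdone m' hm'
            exact ⟨j, by omega, he⟩
      · -- decrement the budget of `m`
        have hs : wrun T X s₀ (t + 1) = ⟨(wrun T X s₀ t).done, (m, k - 1) :: rest⟩ := by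
          rw [wrun_succ]; unfold wstep; simp only [htodo, hsplit]; simp [hk1]
        rw [Inv3, hs]
        refine ⟨fun m' k' rest' heq => ?_, fun m' hm' => ?_⟩
        · simp only [List.cons.injEq, Prod.mk.injEq] at heq
          obtain ⟨⟨rfl, rfl⟩, rfl⟩ := heq
          have e1 : T - (k - 1) = T - k + 1 := by omega
          have e2 : t + 1 - (T - k + 1) = t - (T - k) := by omega
          rw [e1, e2]
          refine ⟨by omega, hhead, fun i hi => ?_⟩
          rcases Nat.lt_or_ge i (T - k) with hi' | hi'
          · exact hfail i hi'
          · have : t - (T - k) + i = t := by omega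
            rw [this]; exact hsplit
        · obtain ⟨j, hj, he⟩ := hdone m' hm'
          exact ⟨j, by omega, he⟩
    · -- split `m = d * (m / d)`
      have hs : wrun T X s₀ (t + 1) = ⟨(wrun T X s₀ t).done, (d, T) :: (m / d, T) :: rest⟩ := by
        rw [wrun_succ]; unfold wstep; simp only [htodo, hsplit]
      rw [Inv3, hs]
      refine ⟨fun m' k' rest' heq => ?_, fun m' hm' => ?_⟩
      · simp only [List.cons.injEq, Prod.mk.injEq] at heq
        obtain ⟨⟨rfl, rfl⟩, -⟩ := heq
        refine ⟨by omega, ?_, fun i hi => by omega⟩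
        simp only [Nat.sub_self, Nat.sub_zero, hs, List.head?_cons]
      · obtain ⟨j, hj, he⟩ := hdone m' hm'
        exact ⟨j, by omega, he⟩

/-- Invariant 3 along the run from `winit n T`. [folklore] -/
theorem inv3_wrun {n : ℕ} (hT : 1 ≤ T) (h : s₀ = winit n T) (t : ℕ) : Inv3 T X s₀ t := by
  have h2 : Inv2 T s₀ := h ▸ inv2_winit n hT
  induction t with
  | zero => exact inv3_zero h
  | succ t ih => exact inv3_succ hT h2 ih

end Episodes

/-- **The dichotomy.** With budget `T ≥ 1` per number and at least `pot T (winit n T)` rounds,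
either the sorted list of finished numbers *is* the prime factorisation of `n`, or some
composite divisor `m > 1` of `n` went through a full episode of `T` failed attempts. [folklore] -/
theorem wrun_dichotomy {n T R : ℕ} {X : ℕ → ℕ} (hn : 1 < n) (hT : 1 ≤ T)
    (hR : pot T (winit n T) ≤ R) :
    ((wrun T X (winit n T) R).done.insertionSort (· ≤ ·) = n.primeFactorsList) ∨
      ∃ j m, j + T ≤ R ∧ 1 < m ∧ m ∣ n ∧ ¬ m.Prime ∧ Episode T X (winit n T) m j := by
  have h1 := inv1_wrun (X := X) (T := T) (inv1_winit hn T) R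
  have hnil := todo_wrun_eq_nil (X := X) hT (inv1_winit hn T) (inv2_winit n hT) hR
  have hentries : (wrun T X (winit n T) R).entries = (wrun T X (winit n T) R).done := by
    simp [WState.entries, hnil]
  by_cases hall : ∀ m ∈ (wrun T X (winit n T) R).done, m.Prime
  · left
    have hprod : (wrun T X (winit n T) R).done.prod = n := hentries ▸ h1.1
    have hperm := Nat.primeFactorsList_unique hprod hall
    exact ((List.perm_insertionSort _ _).trans hperm).eq_of_sortedLE
      (List.sortedLE_insertionSort) (Nat.primeFactorsList_sorted n)
  · right
    push Not at hall
    obtain ⟨m, hm, hmp⟩ := hall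
    obtain ⟨j, hj, he⟩ := (inv3_wrun (X := X) hT rfl R).2 m hm
    have hme : m ∈ (wrun T X (winit n T) R).entries := hentries ▸ hm
    exact ⟨j, m, hj, h1.2 m hme, h1.dvd_of_mem hme, hmp, he⟩

end Shor1997

/-! ### Counting: independent blocks -/

section Counting

open Finset

variable {ι α : Type*} [Fintype ι] [DecidableEq ι] [Fintype α] [DecidableEq α]

/-- **One free coordinate.** If the event `Q` and the target sets `G ω ⊆ α` do not depend on
coordinate `i`, then `|α| · #{ω | Q ω ∧ ω i ∈ G ω} = ∑_{ω : Q ω} |G ω|` (average over the free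
coordinate). [folklore] -/
theorem card_mul_card_filter_coord (i : ι) (Q : (ι → α) → Prop) [DecidablePred Q]
    (G : (ι → α) → Finset α) (hQ : ∀ ω a, Q (Function.update ω i a) ↔ Q ω)
    (hG : ∀ ω a, G (Function.update ω i a) = G ω) :
    Fintype.card α * (univ.filter fun ω => Q ω ∧ ω i ∈ G ω).card =
      ∑ ω ∈ univ.filter Q, (G ω).card := by
  classical
  -- both sides count pairs `(ω, a)`
  let A : Finset ((ι → α) × α) := univ.filter fun p => Q p.1 ∧ p.2 ∈ G p.1
  let B : Finset ((ι → α) × α) := univ.filter fun p => Q p.1 ∧ p.1 i ∈ G p.1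
  have hB : B.card = Fintype.card α * (univ.filter fun ω => Q ω ∧ ω i ∈ G ω).card := by
    have : B = (univ.filter fun ω => Q ω ∧ ω i ∈ G ω) ×ˢ (univ : Finset α) := by
      ext ⟨ω, a⟩; simp [B]
    rw [this, card_product, Finset.card_univ, mul_comm]
  have hA : A.card = ∑ ω ∈ univ.filter Q, (G ω).card := by
    rw [card_filter, Fintype.sum_prod_type, sum_filter]
    refine Finset.sum_congr rfl fun ω _ => ?_
    by_cases hq : Q ω
    · simp only [hq, true_and, if_true]
      rw [← card_filter, filter_mem_eq_inter, univ_inter]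
    · simp [hq]
  -- the involution `(ω, a) ↦ (ω[i ↦ a], ω i)` exchanges them
  let σf : (ι → α) × α → (ι → α) × α := fun p => (Function.update p.1 i p.2, p.1 i)
  have hσ : Function.Involutive σf := by
    rintro ⟨ω, a⟩
    simp [σf, Function.update_idem, Function.update_eq_self]
  have hAB : A.card = B.card := by
    refine card_equiv hσ.toPerm fun p => ?_
    obtain ⟨ω, a⟩ := p
    simp [A, B, σf, Function.Involutive.coe_toPerm, hQ, hG]
  rw [← hB, ← hAB, hA]

variable [Nonempty α]

/-- One free coordinate, inequality form: if every target set has density `≤ d/c`, then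
requiring `ω i ∈ G ω` on a free coordinate `i` shrinks an event by the factor `d/c`.
[folklore] -/
theorem card_filter_coord_le (i : ι) (Q : (ι → α) → Prop) [DecidablePred Q]
    (G : (ι → α) → Finset α) (c d : ℕ) (hQ : ∀ ω a, Q (Function.update ω i a) ↔ Q ω)
    (hG : ∀ ω a, G (Function.update ω i a) = G ω)
    (hcard : ∀ ω, c * (G ω).card ≤ d * Fintype.card α) :
    c * (univ.filter fun ω => Q ω ∧ ω i ∈ G ω).card ≤ d * (univ.filter Q).card := by
  have hpos : 0 < Fintype.card α := Fintype.card_pos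
  refine Nat.le_of_mul_le_mul_left ?_ hpos
  calc Fintype.card α * (c * (univ.filter fun ω => Q ω ∧ ω i ∈ G ω).card)
      = c * ∑ ω ∈ univ.filter Q, (G ω).card := by
        rw [← card_mul_card_filter_coord i Q G hQ hG]; ring
    _ = ∑ ω ∈ univ.filter Q, c * (G ω).card := by rw [mul_sum]
    _ ≤ ∑ ω ∈ univ.filter Q, d * Fintype.card α := sum_le_sum fun ω _ => hcard ω
    _ = Fintype.card α * (d * (univ.filter Q).card) := by
        rw [sum_const, smul_eq_mul]; ring

/-- **Independent blocks (cylinder bound).** Let `co (j), …, co (j + T - 1)` be distinct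
coordinates on which the label `g ω` does not depend, and let every target set `F b` have
density `≤ d/c`. Then the event "`ω (co (j+i)) ∈ F (g ω)` for all `i < T`" has density
`≤ (d/c)^T`. [folklore] -/
theorem card_cylinder_le {β : Type*} (co : ℕ → ι) (j T : ℕ)
    (hco : ∀ i i', i < T → i' < T → co (j + i) = co (j + i') → i = i')
    (g : (ι → α) → β) (hg : ∀ ω i a, i < T → g (Function.update ω (co (j + i)) a) = g ω)
    (F : β → Finset α) (c d : ℕ) (hF : ∀ b, c * (F b).card ≤ d * Fintype.card α) :
    c ^ T * (univ.filter fun ω => ∀ i < T, ω (co (j + i)) ∈ F (g ω)).card ≤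
      d ^ T * Fintype.card α ^ Fintype.card ι := by
  classical
  suffices h : ∀ k ≤ T, c ^ k * (univ.filter fun ω => ∀ i < k, ω (co (j + i)) ∈ F (g ω)).card ≤
      d ^ k * Fintype.card α ^ Fintype.card ι from h T le_rfl
  intro k hk
  induction k with
  | zero => simp
  | succ k ih =>
    have hkT : k < T := hk
    have step := card_filter_coord_le (co (j + k))
      (fun ω => ∀ i < k, ω (co (j + i)) ∈ F (g ω)) (fun ω => F (g ω)) c d
      (fun ω a => ?_) (fun ω a => by simp only [hg ω k a hkT]) (fun ω => hF (g ω))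
    · have hset : (univ.filter fun ω => ∀ i < k + 1, ω (co (j + i)) ∈ F (g ω)) =
          univ.filter fun ω => (∀ i < k, ω (co (j + i)) ∈ F (g ω)) ∧ ω (co (j + k)) ∈ F (g ω) := by
        refine filter_congr fun ω _ => ⟨fun h => ⟨fun i hi => h i (by omega), h k (by omega)⟩,
          fun h i hi => ?_⟩
        rcases Nat.lt_or_ge i k with hi' | hi'
        · exact h.1 i hi'
        · have : i = k := by omega
          subst this; exact h.2
      rw [hset, pow_succ, mul_assoc, pow_succ]
      calc c ^ k * (c * _) ≤ c ^ k * (d * (univ.filter fun ω => ∀ i < k,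
            ω (co (j + i)) ∈ F (g ω)).card) := Nat.mul_le_mul_left _ step
        _ = d * (c ^ k * (univ.filter fun ω => ∀ i < k, ω (co (j + i)) ∈ F (g ω)).card) := by
            ring
        _ ≤ d * (d ^ k * Fintype.card α ^ Fintype.card ι) :=
            Nat.mul_le_mul_left _ (ih (by omega))
        _ = d ^ k * d * Fintype.card α ^ Fintype.card ι := by ring
    · -- the event of the first `k` coordinates is invariant under updating coordinate `k`
      simp only [hg ω k a hkT]
      refine forall₂_congr fun i hi => ?_
      rw [Function.update_of_ne]
      intro heq
      have := hco i k (by omega) hkT heq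
      omega

end Counting

/-! ### Coin blocks -/

section Blocks

open Finset

/-- A block of `B` coin bits, read as a number `< 2 ^ B` (little-endian, via Mathlib's
`finFunctionFinEquiv`). [folklore] -/
def blockEquiv (B : ℕ) : (Fin B → Bool) ≃ Fin (2 ^ B) :=
  ((Equiv.refl (Fin B)).arrowCongr finTwoEquiv.symm).trans finFunctionFinEquiv

/-- The value of a block of coin bits. [folklore] -/
def blockVal {B : ℕ} (a : Fin B → Bool) : ℕ := blockEquiv B a

/-- Block values are `< 2 ^ B`. [folklore] -/
theorem blockVal_lt {B : ℕ} (a : Fin B → Bool) : blockVal a < 2 ^ B := (blockEquiv B a).isLt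

/-- The block values of a sample `ω` of `R` blocks (`0` beyond `R`). [folklore] -/
def Xof {R B : ℕ} (ω : Fin R → Fin B → Bool) (t : ℕ) : ℕ :=
  if h : t < R then blockVal (ω ⟨t, h⟩) else 0

/-- Counting blocks by value. [folklore] -/
theorem card_filter_blockVal (B : ℕ) (P : ℕ → Prop) [DecidablePred P] :
    (univ.filter fun a : Fin B → Bool => P (blockVal a)).card = ((range (2 ^ B)).filter P).card := by
  rw [card_equiv (blockEquiv B) (t := univ.filter fun v : Fin (2 ^ B) => P v) (fun a => by
    simp [blockVal])]
  rw [card_filter, card_filter, Fin.sum_univ_eq_sum_range (f := fun x => if P x then 1 else 0)]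

/-- The sample of `R` blocks of `B` bits read off a coin string (bit `B t + i` is bit `i` of
block `t`; missing bits read `false`). [folklore] -/
def coinBlocks (R B : ℕ) (c : List Bool) : Fin R → Fin B → Bool :=
  fun t i => c.getD (B * t + i) false

/-- The currying bijection `{0,1}^{R·B} ≃ ({0,1}^B)^R` (bit `B t + i` ↦ bit `i` of block `t`).
[folklore] -/
def coinEquiv (R B : ℕ) : (Fin (R * B) → Bool) ≃ (Fin R → Fin B → Bool) :=
  (finProdFinEquiv.arrowCongr (Equiv.refl Bool)).symm.trans (Equiv.curry _ _ _)

/-- Reading blocks off `List.ofFn y` is the currying bijection `coinEquiv`. [folklore] -/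
theorem coinBlocks_ofFn {R B : ℕ} (y : Fin (R * B) → Bool) :
    coinBlocks R B (List.ofFn y) = coinEquiv R B y := by
  funext t i
  have hlt : B * t + i < R * B := by
    calc B * t + i < B * t + B := by omega
      _ = B * (t + 1) := by ring
      _ ≤ B * R := Nat.mul_le_mul_left B t.isLt
      _ = R * B := mul_comm _ _
  simp only [coinBlocks, List.getD_eq_getElem?_getD, List.getElem?_ofFn, hlt, dif_pos,
    Option.getD_some, coinEquiv, Equiv.trans_apply, Equiv.curry_apply, Function.curry,
    Equiv.arrowCongr_symm, Equiv.arrowCongr_apply, Equiv.refl_symm, Equiv.coe_refl,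
    Function.comp_apply, id_eq]
  congr 1
  ext
  simp [finProdFinEquiv_apply_val, add_comm]

end Blocks

namespace Shor1997

/-! ### The failure probability of the driver -/

section Fail

open Finset

/-- The target sets of the cylinder bound: for a top entry `(m, ·)` with `m` composite of size
`≤ B`, the blocks whose value fails to split `m`; empty otherwise. [folklore] -/
def failBlocks (B : ℕ) : Option (ℕ × ℕ) → Finset (Fin B → Bool)
  | none => ∅
  | some e => if 1 < e.1 ∧ ¬ e.1.Prime ∧ e.1.size ≤ B then
      univ.filter fun a => splitStep e.1 (blockVal a) = none else ∅

/-- There are `2 ^ B` blocks of `B` bits. [folklore] -/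
theorem card_blocks (B : ℕ) : Fintype.card (Fin B → Bool) = 2 ^ B := by
  simp

/-- Every target set has density `≤ 5/6` (`splitStep_fail_card`). [folklore] -/
theorem six_mul_card_failBlocks_le (B : ℕ) (b : Option (ℕ × ℕ)) :
    6 * (failBlocks B b).card ≤ 5 * Fintype.card (Fin B → Bool) := by
  rcases b with _ | ⟨m, k⟩
  · simp [failBlocks]
  · simp only [failBlocks]
    split_ifs with h
    · rw [card_filter_blockVal B (fun x => splitStep m x = none), card_blocks]
      exact splitStep_fail_card h.1 h.2.1 h.2.2
    · simp

/-- **Failure count of the driver.** Over samples of `R` independent uniform blocks of `B ≥ size n`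
bits, with budget `T ≥ 1` and `R ≥ pot T (winit n T)` rounds, the samples on which the sorted
output is not the prime factorisation of `n` number at most `R · (5/6)^T · (2^B)^R`.
[cite: Shor1997SICOMP, §5 p.16 (repetition of the reduction)] -/
theorem card_fail_le {n T R B : ℕ} (hn : 1 < n) (hT : 1 ≤ T) (hR : pot T (winit n T) ≤ R)
    (hB : n.size ≤ B) :
    6 ^ T * (univ.filter fun ω : Fin R → Fin B → Bool =>
        (wrun T (Xof ω) (winit n T) R).done.insertionSort (· ≤ ·) ≠ n.primeFactorsList).card ≤
      R * (5 ^ T * Fintype.card (Fin B → Bool) ^ R) := by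
  classical
  have hR0 : 0 < R := by
    have : T ≤ pot T (winit n T) := by rw [pot_winit]; omega
    omega
  -- coordinates and labels of the cylinder bound
  let co : ℕ → Fin R := fun t => ⟨t % R, Nat.mod_lt _ hR0⟩
  let g : ℕ → (Fin R → Fin B → Bool) → Option (ℕ × ℕ) := fun j ω =>
    (wrun T (Xof ω) (winit n T) j).todo.head?
  let E : ℕ → Finset (Fin R → Fin B → Bool) := fun j =>
    univ.filter fun ω => ∀ i < T, ω (co (j + i)) ∈ failBlocks B (g j ω)
  have hco : ∀ {t : ℕ} (ht : t < R), co t = ⟨t, ht⟩ := by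
    intro t ht; simp [co, Nat.mod_eq_of_lt ht]
  -- the failure event is covered by the cylinders `E j`, `j + T ≤ R`
  have hcover : (univ.filter fun ω : Fin R → Fin B → Bool =>
      (wrun T (Xof ω) (winit n T) R).done.insertionSort (· ≤ ·) ≠ n.primeFactorsList) ⊆
      ((range R).filter fun j => j + T ≤ R).biUnion E := by
    intro ω hω
    simp only [mem_filter, mem_univ, true_and] at hω
    rcases wrun_dichotomy (X := Xof ω) hn hT hR with h | ⟨j, m, hjT, hm1, hmn, hmp, hhead, hfail⟩
    · exact absurd h hω
    · simp only [mem_biUnion, mem_filter, mem_range]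
      refine ⟨j, ⟨by omega, hjT⟩, ?_⟩
      simp only [E, mem_filter, mem_univ, true_and]
      intro i hi
      have hsize : m.size ≤ B := (Nat.size_le_size (Nat.le_of_dvd (by omega) hmn)).trans hB
      simp only [g, hhead, failBlocks, hm1, hmp, hsize, not_false_eq_true, and_self, if_true,
        mem_filter, mem_univ, true_and]
      have := hfail i hi
      simp only [Xof, dif_pos (show j + i < R by omega)] at this
      rw [hco (show j + i < R by omega)]
      exact this
  -- each cylinder is small
  have hE : ∀ j, j + T ≤ R → 6 ^ T * (E j).card ≤ 5 ^ T * Fintype.card (Fin B → Bool) ^ R := by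
    intro j hjT
    have h := card_cylinder_le (ι := Fin R) (α := Fin B → Bool) co j T ?_ (g j) ?_
      (failBlocks B) 6 5 (six_mul_card_failBlocks_le B)
    · simpa [Fintype.card_fin] using h
    · intro i i' hi hi' heq
      rw [hco (show j + i < R by omega), hco (show j + i' < R by omega)] at heq
      simp only [Fin.mk.injEq] at heq
      omega
    · intro ω i a hi
      simp only [g]
      rw [wrun_congr (X' := Xof ω)]
      intro t ht
      simp only [Xof]
      split_ifs with htR
      · rw [Function.update_of_ne]
        rw [hco (show j + i < R by omega)]
        intro heq
        simp only [Fin.mk.injEq] at heq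
        omega
      · rfl
  calc 6 ^ T * _ ≤ 6 ^ T * (((range R).filter fun j => j + T ≤ R).biUnion E).card :=
        Nat.mul_le_mul_left _ (card_le_card hcover)
    _ ≤ 6 ^ T * ∑ j ∈ (range R).filter (fun j => j + T ≤ R), (E j).card :=
        Nat.mul_le_mul_left _ card_biUnion_le
    _ = ∑ j ∈ (range R).filter (fun j => j + T ≤ R), 6 ^ T * (E j).card := by rw [mul_sum]
    _ ≤ ∑ j ∈ (range R).filter (fun j => j + T ≤ R), 5 ^ T * Fintype.card (Fin B → Bool) ^ R :=
        sum_le_sum fun j hj => hE j (mem_filter.1 hj).2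
    _ = ((range R).filter fun j => j + T ≤ R).card * (5 ^ T * Fintype.card (Fin B → Bool) ^ R) := by
        rw [sum_const, smul_eq_mul]
    _ ≤ R * (5 ^ T * Fintype.card (Fin B → Bool) ^ R) := by
        refine Nat.mul_le_mul_right _ ?_
        exact (card_filter_le _ _).trans (card_range R).le

/-- **Failure probability of the driver** (real form): with coin strings of length `R · B`,
`P[sorted output ≠ primeFactorsList n] ≤ R · (5/6)^T`. [cite: Shor1997SICOMP, §5 p.16] -/
theorem uniformProb_fail_le {n T R B : ℕ} (hn : 1 < n) (hT : 1 ≤ T) (hR : pot T (winit n T) ≤ R)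
    (hB : n.size ≤ B) :
    uniformProb (R * B) {c | (wrun T (Xof (coinBlocks R B c)) (winit n T) R).done.insertionSort
        (· ≤ ·) ≠ n.primeFactorsList} ≤ R * (5 / 6 : ℝ) ^ T := by
  classical
  rw [Literature.Computability.QuantumComplexity.uniformProb_eq_card_ofFn]
  have hcount := card_fail_le hn hT hR hB (R := R) (B := B)
  rw [card_blocks] at hcount
  have h6 : (0 : ℝ) < 6 ^ T := by positivity
  have h2 : (0 : ℝ) < 2 ^ (R * B) := by positivity
  have hpow : ((2 : ℝ) ^ B) ^ R = 2 ^ (R * B) := by rw [← pow_mul, mul_comm]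
  calc _ = ((univ.filter fun ω : Fin R → Fin B → Bool =>
        (wrun T (Xof ω) (winit n T) R).done.insertionSort (· ≤ ·) ≠ n.primeFactorsList).card : ℝ) /
          2 ^ (R * B) := by
        congr 2
        refine card_equiv (coinEquiv R B) fun y => ?_
        simp only [mem_filter, mem_univ, true_and, Set.mem_setOf_eq, coinBlocks_ofFn]
    _ ≤ R * (5 / 6 : ℝ) ^ T := by
        rw [div_le_iff₀ h2, div_pow,
          show (R : ℝ) * (5 ^ T / 6 ^ T) * 2 ^ (R * B) = R * (5 ^ T * 2 ^ (R * B)) / 6 ^ T by ring,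
          le_div_iff₀ h6]
        calc (_ : ℝ) * 6 ^ T = 6 ^ T * _ := mul_comm _ _
          _ ≤ R * (5 ^ T * (2 ^ B) ^ R) := by exact_mod_cast hcount
          _ = R * (5 ^ T * 2 ^ (R * B)) := by rw [hpow]

end Fail

end Shor1997

/-! ### Parameters and the success probability of the classical part -/

/-- The counting probability is monotone in the event (a deliberate addition to the
`uniformProb` API of `Randomized`, in its home namespace). [folklore] -/
theorem uniformProb_mono (m : ℕ) {E E' : Set (List Bool)} (h : E ⊆ E') :
    uniformProb m E ≤ uniformProb m E' := by
  classical
  unfold uniformProb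
  refine div_le_div_of_nonneg_right ?_ (by positivity)
  exact_mod_cast Finset.card_le_card fun r hr => by
    simp only [Finset.mem_filter, Finset.mem_univ, true_and] at hr ⊢
    exact h hr

/-- Binary decoding of a string of length `L` gives a number `< 2 ^ (L + 1)` (Mathlib's
`decodeNat` reads little-endian digits with an implicit leading `1`, and `[]` as `0`).
[folklore] -/
theorem decodeNat_lt (l : List Bool) : decodeNat l < 2 ^ (l.length + 1) := by
  have hpos : ∀ l : List Bool, (decodePosNum l : ℕ) < 2 ^ (l.length + 1) := by
    intro l
    induction l with
    | nil => simp [decodePosNum]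
    | cons b l ih =>
      cases b
      · simp only [decodePosNum, PosNum.cast_bit0, List.length_cons, pow_succ] at ih ⊢
        omega
      · simp only [decodePosNum, List.length_cons]
        split_ifs with h
        · subst h; simp
        · simp only [PosNum.cast_bit1, pow_succ] at ih ⊢
          omega
  unfold decodeNat decodeNum
  split_ifs with h
  · simp
  · have := hpos l
    simpa using this

namespace Shor1997

/-- Block length for inputs of length `L`: `B = L + 1 ≥ size n` bits. [folklore] -/
def blockLen (L : ℕ) : ℕ := L + 1

/-- Attempt budget per number for inputs of length `L`: `T = 32 (L + 1)`. [folklore] -/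
def budget (L : ℕ) : ℕ := 32 * (L + 1)

/-- Number of rounds for inputs of length `L`: `R = 2 · B · T = 64 (L + 1)²`. [folklore] -/
def rounds (L : ℕ) : ℕ := 64 * (L + 1) ^ 2

/-- Number of coins for inputs of length `L`: `R · B = 64 (L + 1)³`. [folklore] -/
def coinLen (L : ℕ) : ℕ := rounds L * blockLen L

/-- `coinLen L = 64 (L + 1)³`. [folklore] -/
theorem coinLen_eq (L : ℕ) : coinLen L = 64 * (L + 1) ^ 3 := by
  simp [coinLen, rounds, blockLen]; ring

/-- The classical driver on the number `n`: trivial for `n ≤ 1`, otherwise `R` rounds of the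
work-list machine with budget `T`, output sorted.
[cite: Shor1997SICOMP, §5 p.16 (the reduction, repeated and recursed)] -/
def shorDriver (n T R : ℕ) (X : ℕ → ℕ) : List ℕ :=
  if n ≤ 1 then [] else ((wrun T X (winit n T) R).done).insertionSort (· ≤ ·)

/-- **The classical part of Shor's factoring algorithm** as a string function: on `⟨x, c⟩`
(`boolPair`; `x` the binary encoding of `n`, `c` the coin string) it runs the driver with the
parameters of `|x|`, drawing round `t`'s candidate from the `t`-th block of `c`, each order
`ord_m(x)` being *the true order* (`orderOf`, supplied in the algorithm by the order-finding
subroutine), and outputs the encoded sorted list of factors found.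
[cite: Shor1997SICOMP, §5 pp.15–16 (the classical reduction around order finding)] -/
def shorClassicalPair (x c : List Bool) : List Bool :=
  encodingListNatBool.encode
    (shorDriver (decodeNat x) (budget x.length) (rounds x.length)
      (Xof (coinBlocks (rounds x.length) (blockLen x.length) c)))

/-- `shorClassical` on the paired string `w = ⟨x, c⟩` (see `shorClassicalPair`).
[cite: Shor1997SICOMP, §5 pp.15–16 (the classical reduction around order finding)] -/
def shorClassical (w : List Bool) : List Bool :=
  shorClassicalPair (boolUnpair w).1 (boolUnpair w).2

/-- `shorClassical ⟨x, c⟩ = shorClassicalPair x c`. [folklore] -/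
@[simp] theorem shorClassical_boolPair (x c : List Bool) :
    shorClassical (boolPair x c) = shorClassicalPair x c := by
  simp [shorClassical]

/-- The round budget suffices: `pot T (winit n T) = T(2Ω(n) - 1) ≤ 2 (L+1) T = R` since
`Ω(n) ≤ log₂ n < L + 1`. [folklore] -/
theorem pot_winit_le_rounds {n : ℕ} (hn : 1 < n) {L : ℕ} (hnL : n < 2 ^ (L + 1)) :
    pot (budget L) (winit n (budget L)) ≤ rounds L := by
  rw [pot_winit]
  have hΩ : Ω n < L + 1 := by
    have h := two_pow_cardFactors_le (m := n) (by omega)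
    exact (Nat.pow_lt_pow_iff_right (by norm_num)).1 (lt_of_le_of_lt h hnL)
  have h1 := one_le_cardFactors hn
  calc budget L + budget L * (2 * Ω n - 2) ≤ budget L + budget L * (2 * L) :=
        Nat.add_le_add_left (Nat.mul_le_mul_left _ (by omega)) _
    _ ≤ rounds L := by simp only [budget, rounds]; nlinarith

/-- The numerical heart of the amplification: `R · (5/6)^T ≤ 1/4` for `R = 64 (L+1)²`,
`T = 32 (L+1)` (`(5/6)^32 ≤ 1/256` and `(L+1)² ≤ 256^L`). [folklore] -/
theorem rounds_mul_pow_le (L : ℕ) : (rounds L : ℝ) * (5 / 6 : ℝ) ^ budget L ≤ 1 / 4 := by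
  have h32 : ((5 : ℝ) / 6) ^ 32 ≤ 1 / 256 := by norm_num
  have hsq : ∀ L : ℕ, (L + 1) ^ 2 ≤ 256 ^ L := by
    intro L
    induction L with
    | zero => norm_num
    | succ L ih =>
      calc (L + 1 + 1) ^ 2 ≤ (2 * (L + 1)) ^ 2 := Nat.pow_le_pow_left (by omega) 2
        _ = 4 * (L + 1) ^ 2 := by ring
        _ ≤ 256 * 256 ^ L := by omega
        _ = 256 ^ (L + 1) := by rw [pow_succ]; ring
  have hpow : ((5 : ℝ) / 6) ^ budget L ≤ (1 / 256) ^ (L + 1) := by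
    rw [budget, pow_mul]
    exact pow_le_pow_left₀ (by positivity) h32 _
  have hR : (rounds L : ℝ) = 64 * ((L : ℝ) + 1) ^ 2 := by simp [rounds]
  have hsq' : ((L : ℝ) + 1) ^ 2 ≤ 256 ^ L := by exact_mod_cast hsq L
  calc (rounds L : ℝ) * (5 / 6 : ℝ) ^ budget L ≤ 64 * ((L : ℝ) + 1) ^ 2 * (1 / 256) ^ (L + 1) := by
        rw [hR]; exact mul_le_mul_of_nonneg_left hpow (by positivity)
    _ ≤ 64 * (256 : ℝ) ^ L * (1 / 256) ^ (L + 1) := by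
        refine mul_le_mul_of_nonneg_right ?_ (by positivity)
        exact mul_le_mul_of_nonneg_left hsq' (by norm_num)
    _ = 1 / 4 := by
        rw [pow_succ, one_div_pow]
        field_simp
        ring

/-- **Success probability of the classical part** (Shor 1997, §5: the reduction succeeds with
constant probability per attempt, so polynomially many attempts factor `n` completely except
with small probability). For every input `x`, with `64 (|x|+1)³` uniform coins,
`shorClassical ⟨x, c⟩` is the encoded prime factorisation of `decodeNat x` with probability
`≥ 3/4`. [cite: Shor1997SICOMP, §5 p.16 (success probability of the reduction)] -/
theorem shorClassical_success (x : List Bool) :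
    3 / 4 ≤ uniformProb (coinLen x.length)
      {c | shorClassical (boolPair x c) = encodingListNatBool.encode (decodeNat x).primeFactorsList} := by
  by_cases hn1 : decodeNat x ≤ 1
  · have : {c | shorClassical (boolPair x c) =
        encodingListNatBool.encode (decodeNat x).primeFactorsList} = Set.univ := by
      refine Set.eq_univ_of_forall fun c => ?_
      simp only [Set.mem_setOf_eq, shorClassical_boolPair, shorClassicalPair, shorDriver, hn1,
        if_true]
      congr 1
      rcases Nat.le_one_iff_eq_zero_or_eq_one.1 hn1 with h | h <;> simp [h]
    rw [this, uniformProb_univ]; norm_num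
  push Not at hn1
  have hnL : decodeNat x < 2 ^ (x.length + 1) := decodeNat_lt x
  have hsize : (decodeNat x).size ≤ blockLen x.length := Nat.size_le.2 hnL
  have hT : 1 ≤ budget x.length := by simp only [budget]; omega
  have hfail := uniformProb_fail_le (R := rounds x.length) hn1 hT (pot_winit_le_rounds hn1 hnL) hsize
  have hnum := rounds_mul_pow_le x.length
  set F : Set (List Bool) := {c | (wrun (budget x.length) (Xof (coinBlocks (rounds x.length)
      (blockLen x.length) c)) (winit (decodeNat x) (budget x.length))
      (rounds x.length)).done.insertionSort (· ≤ ·) ≠ (decodeNat x).primeFactorsList} with hF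
  have hsub : Fᶜ ⊆
      {c | shorClassical (boolPair x c) = encodingListNatBool.encode (decodeNat x).primeFactorsList} := by
    intro c hc
    simp only [hF, Set.mem_compl_iff, Set.mem_setOf_eq, not_not] at hc
    simp only [Set.mem_setOf_eq, shorClassical_boolPair, shorClassicalPair, shorDriver,
      show ¬ decodeNat x ≤ 1 by omega, if_false, hc]
  have hcompl := Literature.Computability.QuantumComplexity.uniformProb_compl (coinLen x.length) F
  have hmono := uniformProb_mono (coinLen x.length) hsub
  change uniformProb (coinLen x.length) F ≤ _ at hfail
  linarith

end Shor1997

end Literature.Computability.Cryptography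

end
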